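import Summits.BirchSwinnertonDyer.Rank1Residual.Additive.X4RankZeroVisibleRefinedCertificateSockets
import Summits.BirchSwinnertonDyer.Rank1Residual.GaloisImage.VisibleWitnessHybridPlacesNonsplit
import Summits.BirchSwinnertonDyer.Rank1Residual.GaloisImage.CongruenceVisibilityPotMult
import Summits.BirchSwinnertonDyer.Rank1Residual.Additive.X4ThreeResCertKernel
import Summits.BirchSwinnertonDyer.Rank1Residual.Additive.UnramifiedBaseChange
import Summits.BirchSwinnertonDyer.Rank1Residual.Additive.JValuationOfIntModel
import Literature.NumberTheory.EllipticCurves.Rank1Residual.AnomalousDictionaryProofs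
import HarnessLib

/-!
# The seven free kinds of the REFINED visibility certificate, each as a DECIDED disjunct from the two
# integer models (cell `b2b-bsdres`, team n1011, ROW T-D44T-REC TOOL; seat p09 GEN 13; route planner 1
# ROUTE-1 §44 / §49.3 / §50.2 — the D44-family records road; lead R5-95 (g) ST-50d)

HONEST FRAMING (cell `b2b-bsdres`, run/shared/lean/b2b/bsd-rank1-residual/, verbatim in every
file): the goal of the cell is to DELETE the COMBINATION-SHAPED residual classes of the
Birch–Swinnerton-Dyer formula for ALL analytic-rank `≤ 1` elliptic curves over `ℚ` — "full BSD
formula for every rank `≤ 1` curve in class `C`" assembled STRICTLY from published theorems — so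
that the rank-`≤ 1` remainder becomes exactly the CONSTRUCTION-SHAPED classes, which are TYPED
(missing-input `Prop`s), NOT attempted. This is not "finishing BSD". Team n1011 (N10 / N11, the
additive block X4 ∧ `p = 3`): research route on the CONSTRUCTION-SHAPED class X4; no claim beyond
the stated classes; nothing is booked; no mark / label / count / road letter is changed by this file.
THIS FILE IS A TOOL: theorems only (no definition, no named fact, no `sorry`); it closes nothing by
itself — it is records PLUMBING for the `hplaces` binder of n1011-p04's sockets
`X4RankZero.bsdp_three_potMult_of_congr_of_places₇_of_primeList[_paidThree]` /
`X4RankZero.bsdp_three_of_congr_of_places₇_of_kato_of_primeList_paidThree`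
(`Additive/X4RankZeroVisibleRefinedCertificateSockets.lean`).

## What

The `hplaces` binder of the seven-kind sockets asks, at each place `v` over a listed prime `q`, for ONE
of seven disjuncts.  For a records seat the inputs are two literal integer models `E₀` (the row `E = W`,
globally minimal, `integralModelInt W = E₀`) and `F₀` (the partner `E′ = W′`), and per place a handful
of `decide`-able certificates.  This file turns those certificates into EXACTLY the disjunct's
conjunction, one theorem per kind, so that a record's place block is a single `exact` (n1011-p14 /
p18 row-shape discipline: every local binder IN THE KERNEL, evidence columns displayed):

* `PlacesSeven.kind_i_of_checkAt` — kind (i), `q ≠ 3`: `3 ∉ v ∧ #E′(ℚ_v)[3] = 1` from n1011-p17's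
  T-LOC3L decider `threeTorsionCheckAt q (F₀) k cert = some 0` (= `LocalTorsion3At.free_kind_i_of_checkAt`
  in `integralModelInt` currency);
* `PlacesSeven.kind_ii_of_roots_of_checkAt` — kind (ii): both curves SPLIT multiplicative at `v`
  (`q ∣ Δ`, `q ∤ c₄`, a root of the node-tangent quadratic mod `q`, for `E₀` and for `F₀`) and
  `#E(ℚ_v)[3] ≤ 3` from the decider on `E₀` (`some S`, `S ≤ 1`);
* `PlacesSeven.kind_iii_of_sqFlagAt` — kind (iii): both multiplicative (`q ∣ Δ`, `q ∤ c₄` twice), same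
  twist class (`sqFlagAt q (N·D) w = true` for `γ(E)/γ(E′) = N/D`, `γ = −c₄/c₆`) and `μ₃(ℚ_v) = 1`
  (`sqFlagAt q (−3) w₃ = false`);
* `PlacesSeven.kind_iv'_of_sqFlagAt` — kind (iv′), `q ≠ 3`: `E` multiplicative and NOT split
  (`sqFlagAt q (N·D) w = false` for `γ(E) = N/D`), `E′` good (`q ∤ Δ(F₀)`), `3 ∉ v`;
* `PlacesSeven.kind_vi_of_sqFlagAt` — kind (vi), `q ≠ 3`: `E` good, `E′` multiplicative not split, `3 ∉ v`;
* `PlacesSeven.kind_iii'_of_sqFlagAt` — kind (iii′) (the one kind usable AT `3`; this lineage's M2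
  `TwistedKummer.h1Equiv_mem_selmerLocalKer_of_one_lt_valuation_j`, p311741): `1 < v(j(E))`,
  `1 < v(j(E′))` from `ord_q j < 0` read off the two integer models (`q^{a+1} ∤ c₄`, `q^{3a+1} ∣ Δ`),
  same twist class, `μ₃(ℚ_v) = 1`;
* `PlacesSeven.kind_vii_of_checkAt` — kind (vii), `q ≠ 3` (route planner 1's L44(b), the D44 kind):
  both curves ADDITIVE at `v` (`q ∣ Δ`, `q ∣ c₄` twice), `3 ∉ v`, `#E′(ℚ_v)[3] = 3` from the decider
  on `F₀` (`some 1`).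

Every ingredient is a tree theorem, reused BY NAME: `LocalTorsion3At.natCard_ker_nsmul_three_adicCompletion_eq_of_intModel_of_checkAt`
(p17 T-LOC3L / p18 bridge), `DivisionDecider.hasSplitMultiplicativeReductionAt_of_intModel_of_root` (p17 D9),
`WeierstrassCurve.hasMultiplicativeReductionAt_of_dvd_of_not_dvd`, `hasGoodReductionAt_map_of_not_dvd`,
`addv_of_intModel` + `hasAdditiveReductionAt_of_addv`, `LocalTorsion3At.exists_eq_sq_mul_of_sqFlagAt` /
`not_isSquare_algebraMap_adicCompletion_of_sqFlagAt` / `forall_pow_three_eq_one_adicCompletion_of_sqFlagAt`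
(p17 L6), `TwistedKummer.one_lt_valuation_iff_padicValRat_neg` (p09 M2), `padicValRat_j_neg_of_intModel`.

References: [SilvermanAEC2009] VII.5 Prop. 5.1, VII.3.1 and Ex. 3.7; [SilvermanATAEC1994] Ch. V Lemma 5.2 (c),
Thm. 5.3, Cor. 5.4; [Serre1973] Ch. II §3.3; cells/n1011/ROUTE-1.md §44 (L44, L44-bis), §49.3, §50.2.
-/

set_option autoImplicit false

noncomputable section

open scoped Classical NumberField
open IsDedekindDomain NumberField WeierstrassCurve Rat.HeightOneSpectrum
  Literature.NumberTheory.EllipticCurves Literature.NumberTheory.EllipticCurves.Rank1Residual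
  Summit.BirchSwinnertonDyer.BirchSwinnertonDyer.Rank1Residual.IntModel
  Summit.BirchSwinnertonDyer.Rank1Residual.GaloisImage
  Summit.BirchSwinnertonDyer.Rank1Residual.GaloisImage.LocalTorsion3At

namespace Summit.BirchSwinnertonDyer.Rank1Residual.Additive.PlacesSeven

variable (q : ℕ) [hq : Fact q.Prime]

/-! ### Plumbing: the place of `q`, reduction types from an integer model -/

/-- The place `v` with `primesEquiv v = q` IS `primesEquiv.symm q`. [folklore] -/
theorem eq_primesEquiv_symm_of_eq {v : HeightOneSpectrum (𝓞 ℚ)} (hv : (primesEquiv v : ℕ) = q) :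
    v = (primesEquiv (R := 𝓞 ℚ)).symm ⟨q, hq.out⟩ := by
  rw [Equiv.eq_symm_apply]; exact Subtype.ext hv

/-- **Additive reduction at the place of `q` from the integer model** (`q ∣ Δ(E₀)`, `q ∣ c₄(E₀)`,
`W` globally minimal with integer model `E₀`; Silverman VII.5.1 (c) via the cell's `addv_of_intModel`).
[cite: SilvermanAEC2009, VII.5 Prop. 5.1 (c)] -/
theorem hasAdditiveReductionAt_of_intModel (W : WeierstrassCurve ℚ) [W.IsElliptic]
    [W.IsGloballyMinimal] {E₀ : WeierstrassCurve ℤ} (hI : W.integralModelInt = E₀)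
    {v : HeightOneSpectrum (𝓞 ℚ)} (hv : (primesEquiv v : ℕ) = q)
    (hΔ : (q : ℤ) ∣ E₀.Δ) (hc₄ : (q : ℤ) ∣ E₀.c₄) : W.HasAdditiveReductionAt v := by
  rw [eq_primesEquiv_symm_of_eq q hv]
  exact hasAdditiveReductionAt_of_addv W q (addv_of_intModel hI q hΔ hc₄)

omit hq in
/-- **Multiplicative reduction at the place of `q` from the integer model** (`q ∣ Δ(E₀)`,
`q ∤ c₄(E₀)`). [cite: SilvermanAEC2009, VII.5 Prop. 5.1 (b)] -/
theorem hasMultiplicativeReductionAt_of_intModel (W : WeierstrassCurve ℚ) [W.IsElliptic]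
    [W.IsGloballyMinimal] {E₀ : WeierstrassCurve ℤ} (hI : W.integralModelInt = E₀)
    {v : HeightOneSpectrum (𝓞 ℚ)} (hv : (primesEquiv v : ℕ) = q)
    (hΔ : (q : ℤ) ∣ E₀.Δ) (hc₄ : ¬ (q : ℤ) ∣ E₀.c₄) : W.HasMultiplicativeReductionAt v := by
  have hqv : ((primesEquiv v : ℕ) : ℤ) = (q : ℤ) := by rw [hv]
  exact W.hasMultiplicativeReductionAt_of_dvd_of_not_dvd v
    (by rw [minimalDiscriminantInt, hI, hqv]; exact hΔ) (by rw [hI, hqv]; exact hc₄)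

omit hq in
/-- **Good reduction at the place of `q` from the integer model** (`q ∤ Δ(E₀)`).
[cite: SilvermanAEC2009, VII.5 Prop. 5.1 (a)] -/
theorem hasGoodReductionAt_of_intModel (W : WeierstrassCurve ℚ) [W.IsElliptic]
    [W.IsGloballyMinimal] {E₀ : WeierstrassCurve ℤ} (hI : W.integralModelInt = E₀)
    {v : HeightOneSpectrum (𝓞 ℚ)} (hv : (primesEquiv v : ℕ) = q)
    (hΔ : ¬ (q : ℤ) ∣ E₀.Δ) : W.HasGoodReductionAt v := by
  have hqv : ((primesEquiv v : ℕ) : ℤ) = (q : ℤ) := by rw [hv]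
  have hE : E₀.map (Int.castRingHom ℚ) = W := by
    have h := W.map_integralModelInt
    rwa [hI] at h
  rw [← hE]
  exact hasGoodReductionAt_map_of_not_dvd E₀ v (by rw [hqv]; exact hΔ)

/-- `γ = −c₄/c₆` of a globally minimal `W` is `−c₄(E₀)/c₆(E₀)` of its integer model. [folklore] -/
theorem neg_c₄_div_c₆_eq_intModel (W : WeierstrassCurve ℚ) [W.IsGloballyMinimal]
    {E₀ : WeierstrassCurve ℤ} (hI : W.integralModelInt = E₀) :
    -(W.c₄ / W.c₆) = -((E₀.c₄ : ℚ) / (E₀.c₆ : ℚ)) := by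
  obtain ⟨h4, h6⟩ := DivisionDecider.c₄_eq_intModel W
  rw [h4, h6, hI]

/-! ### Kind (i): `3 ∉ v`, `#E′(ℚ_v)[3] = 1` -/

/-- **Kind (i), decided** (`q ≠ 3`): `((3 : ℕ) : 𝓞 ℚ) ∉ v ∧ #ker([3] : E′(ℚ_v)) = 1` for the partner `W′`
with integer model `⟨a₁, …, a₆⟩` from `threeTorsionCheckAt q a₁ … a₆ k cert = some 0` (n1011-p17's T-LOC3L
decider, any reduction type). [cite: SilvermanAEC2009, VII.3.1 and Ex. 3.7] -/
theorem kind_i_of_checkAt (hq3 : q ≠ 3) (W' : WeierstrassCurve ℚ) [W'.IsElliptic] [W'.IsGloballyMinimal]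
    {a₁ a₂ a₃ a₄ a₆ : ℤ} (hI' : W'.integralModelInt = ⟨a₁, a₂, a₃, a₄, a₆⟩)
    {v : HeightOneSpectrum (𝓞 ℚ)} (hv : (primesEquiv v : ℕ) = q)
    {k : ℕ} {cert : List (ℤ × ℕ × ℕ × ℕ)} (h : threeTorsionCheckAt q a₁ a₂ a₃ a₄ a₆ k cert = some 0) :
    ((3 : ℕ) : 𝓞 ℚ) ∉ v.asIdeal ∧
      Nat.card (nsmulAddMonoidHom 3 : (W'.baseChange (v.adicCompletion ℚ)).toAffine.Point →+
        (W'.baseChange (v.adicCompletion ℚ)).toAffine.Point).ker = 1 := by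
  refine ⟨three_notMem_asIdeal_of_primesEquiv_eq q hq3 hv, ?_⟩
  rw [natCard_ker_nsmul_three_adicCompletion_eq_of_intModel_of_checkAt q a₁ a₂ a₃ a₄ a₆ hq3 W' hI' h hv]

/-! ### Kind (ii): split / split, `#E(ℚ_v)[3] ≤ 3` -/

/-- **Kind (ii), decided**: both curves SPLIT multiplicative at `v` (root certificates `t`, `t′` of the
node-tangent quadratics of `E₀`, `F₀` mod `q`; `q ∣ Δ`, `q ∤ c₄`) and `#ker([3] : E(ℚ_v)) ≤ 3` from
`threeTorsionCheckAt q (E₀) k cert = some S`, `S ≤ 1` (`q ≠ 3`). [cite: SilvermanAEC2009, VII.5 Prop. 5.1 (b)]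
[cite: SilvermanAEC2009, VII.3.1 and Ex. 3.7] -/
theorem kind_ii_of_roots_of_checkAt (hq3 : q ≠ 3) (W W' : WeierstrassCurve ℚ) [W.IsElliptic]
    [W'.IsElliptic] [W.IsGloballyMinimal] [W'.IsGloballyMinimal] {a₁ a₂ a₃ a₄ a₆ : ℤ}
    {F₀ : WeierstrassCurve ℤ} (hI : W.integralModelInt = ⟨a₁, a₂, a₃, a₄, a₆⟩)
    (hI' : W'.integralModelInt = F₀) {v : HeightOneSpectrum (𝓞 ℚ)} (hv : (primesEquiv v : ℕ) = q)
    (hΔ : (q : ℤ) ∣ (⟨a₁, a₂, a₃, a₄, a₆⟩ : WeierstrassCurve ℤ).Δ)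
    (hc₄ : ¬ (q : ℤ) ∣ (⟨a₁, a₂, a₃, a₄, a₆⟩ : WeierstrassCurve ℤ).c₄) (t : ZMod q)
    (ht : ((⟨a₁, a₂, a₃, a₄, a₆⟩ : WeierstrassCurve ℤ).c₄ : ZMod q) * t ^ 2 +
      ((a₁ * (⟨a₁, a₂, a₃, a₄, a₆⟩ : WeierstrassCurve ℤ).c₄ : ℤ) : ZMod q) * t -
      ((54 * (⟨a₁, a₂, a₃, a₄, a₆⟩ : WeierstrassCurve ℤ).b₆ -
        3 * (⟨a₁, a₂, a₃, a₄, a₆⟩ : WeierstrassCurve ℤ).b₂ * (⟨a₁, a₂, a₃, a₄, a₆⟩ : WeierstrassCurve ℤ).b₄ +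
        a₂ * (⟨a₁, a₂, a₃, a₄, a₆⟩ : WeierstrassCurve ℤ).c₄ : ℤ) : ZMod q) = 0)
    (hΔ' : (q : ℤ) ∣ F₀.Δ) (hc₄' : ¬ (q : ℤ) ∣ F₀.c₄) (t' : ZMod q)
    (ht' : (F₀.c₄ : ZMod q) * t' ^ 2 + ((F₀.a₁ * F₀.c₄ : ℤ) : ZMod q) * t' -
      ((54 * F₀.b₆ - 3 * F₀.b₂ * F₀.b₄ + F₀.a₂ * F₀.c₄ : ℤ) : ZMod q) = 0)
    {k S : ℕ} {cert : List (ℤ × ℕ × ℕ × ℕ)} (h : threeTorsionCheckAt q a₁ a₂ a₃ a₄ a₆ k cert = some S)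
    (hS : S ≤ 1) :
    W.HasSplitMultiplicativeReductionAt v ∧ W'.HasSplitMultiplicativeReductionAt v ∧
      Nat.card (nsmulAddMonoidHom 3 : (W.baseChange (v.adicCompletion ℚ)).toAffine.Point →+
        (W.baseChange (v.adicCompletion ℚ)).toAffine.Point).ker ≤ 3 := by
  refine ⟨DivisionDecider.hasSplitMultiplicativeReductionAt_of_intModel_of_root q W hI hv hΔ hc₄ t ht,
    DivisionDecider.hasSplitMultiplicativeReductionAt_of_intModel_of_root q W' hI' hv hΔ' hc₄' t' ht', ?_⟩
  rw [natCard_ker_nsmul_three_adicCompletion_eq_of_intModel_of_checkAt q a₁ a₂ a₃ a₄ a₆ hq3 W hI h hv]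
  omega

/-! ### Kind (iii): multiplicative / multiplicative, same twist class, `μ₃(ℚ_v) = 1` -/

/-- **Kind (iii), decided**: both curves multiplicative at `v` (`q ∣ Δ`, `q ∤ c₄` on `E₀` and `F₀`),
`ι γ(E) = r² · ι γ(E′)` in `ℚ_v` from `sqFlagAt q (N·D) w = true` (`γ(E)/γ(E′) = N/D` on the integer
models, `q^w ∥ N·D`), and `μ₃(ℚ_v) = 1` from `sqFlagAt q (−3) w₃ = false`.
[cite: SilvermanAEC2009, VII.5 Prop. 5.1 (b)] [cite: SilvermanATAEC1994, Ch. V Lemma 5.2 (c), Thm. 5.3, Cor. 5.4]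
[cite: Serre1973, Ch. II §3.3] -/
theorem kind_iii_of_sqFlagAt (W W' : WeierstrassCurve ℚ) [W.IsElliptic] [W'.IsElliptic]
    [W.IsGloballyMinimal] [W'.IsGloballyMinimal] {E₀ F₀ : WeierstrassCurve ℤ}
    (hI : W.integralModelInt = E₀) (hI' : W'.integralModelInt = F₀)
    {v : HeightOneSpectrum (𝓞 ℚ)} (hv : (primesEquiv v : ℕ) = q)
    (hΔ : (q : ℤ) ∣ E₀.Δ) (hc₄ : ¬ (q : ℤ) ∣ E₀.c₄) (hΔ' : (q : ℤ) ∣ F₀.Δ) (hc₄' : ¬ (q : ℤ) ∣ F₀.c₄)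
    (hc₆' : F₀.c₆ ≠ 0) {N D : ℤ} (hD : D ≠ 0)
    (hAB : (-((E₀.c₄ : ℚ) / (E₀.c₆ : ℚ))) / (-((F₀.c₄ : ℚ) / (F₀.c₆ : ℚ))) = (N : ℚ) / (D : ℚ))
    {w : ℕ} (hw : (q : ℤ) ^ w ∣ N * D) (hw' : ¬ (q : ℤ) ^ (w + 1) ∣ N * D)
    (hflag : sqFlagAt q (N * D) w = true)
    {w₃ : ℕ} (hw₃ : (q : ℤ) ^ w₃ ∣ (-3 : ℤ)) (hw₃' : ¬ (q : ℤ) ^ (w₃ + 1) ∣ (-3 : ℤ))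
    (hflag₃ : sqFlagAt q (-3) w₃ = false) :
    W.HasMultiplicativeReductionAt v ∧ W'.HasMultiplicativeReductionAt v ∧
      (∃ r : v.adicCompletion ℚ, algebraMap ℚ (v.adicCompletion ℚ) (-(W.c₄ / W.c₆)) =
        r ^ 2 * algebraMap ℚ (v.adicCompletion ℚ) (-(W'.c₄ / W'.c₆))) ∧
      (∀ ζ : v.adicCompletion ℚ, ζ ^ 3 = 1 → ζ = 1) := by
  have hc₄F : F₀.c₄ ≠ 0 := fun h0 ↦ hc₄' (h0 ▸ dvd_zero _)
  have hB : -(W'.c₄ / W'.c₆) ≠ 0 := by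
    rw [neg_c₄_div_c₆_eq_intModel W' hI', neg_ne_zero, div_ne_zero_iff]
    exact ⟨by exact_mod_cast hc₄F, by exact_mod_cast hc₆'⟩
  have hAB' : (-(W.c₄ / W.c₆)) / (-(W'.c₄ / W'.c₆)) = (N : ℚ) / (D : ℚ) := by
    rw [neg_c₄_div_c₆_eq_intModel W hI, neg_c₄_div_c₆_eq_intModel W' hI']; exact hAB
  exact ⟨hasMultiplicativeReductionAt_of_intModel q W hI hv hΔ hc₄,
    hasMultiplicativeReductionAt_of_intModel q W' hI' hv hΔ' hc₄',
    exists_eq_sq_mul_of_sqFlagAt v hv hB hD hAB' hw hw' hflag,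
    forall_pow_three_eq_one_adicCompletion_of_sqFlagAt v hv hw₃ hw₃' hflag₃⟩

/-! ### Kind (iv′): multiplicative non-split / good, `3 ∉ v` -/

/-- **Kind (iv′), decided** (`q ≠ 3`): `E` multiplicative at `v` (`q ∣ Δ(E₀)`, `q ∤ c₄(E₀)`) and NOT
split (`sqFlagAt q (N·D) w = false` for `γ(E) = −c₄(E₀)/c₆(E₀) = N/D`), `E′` good (`q ∤ Δ(F₀)`), `3 ∉ v`.
[cite: SilvermanAEC2009, VII.5 Prop. 5.1] [cite: SilvermanATAEC1994, Ch. V Thm. 5.3] -/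
theorem kind_iv'_of_sqFlagAt (hq3 : q ≠ 3) (W W' : WeierstrassCurve ℚ) [W.IsElliptic] [W'.IsElliptic]
    [W.IsGloballyMinimal] [W'.IsGloballyMinimal] {E₀ F₀ : WeierstrassCurve ℤ}
    (hI : W.integralModelInt = E₀) (hI' : W'.integralModelInt = F₀)
    {v : HeightOneSpectrum (𝓞 ℚ)} (hv : (primesEquiv v : ℕ) = q)
    (hΔ : (q : ℤ) ∣ E₀.Δ) (hc₄ : ¬ (q : ℤ) ∣ E₀.c₄) {N D : ℤ} (hD : D ≠ 0)
    (hγ : -((E₀.c₄ : ℚ) / (E₀.c₆ : ℚ)) = (N : ℚ) / (D : ℚ))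
    {w : ℕ} (hw : (q : ℤ) ^ w ∣ N * D) (hw' : ¬ (q : ℤ) ^ (w + 1) ∣ N * D)
    (hflag : sqFlagAt q (N * D) w = false) (hΔ' : ¬ (q : ℤ) ∣ F₀.Δ) :
    W.HasMultiplicativeReductionAt v ∧
      ¬ IsSquare (algebraMap ℚ (v.adicCompletion ℚ) (-(W.c₄ / W.c₆))) ∧
      W'.HasGoodReductionAt v ∧ ((3 : ℕ) : 𝓞 ℚ) ∉ v.asIdeal := by
  refine ⟨hasMultiplicativeReductionAt_of_intModel q W hI hv hΔ hc₄, ?_,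
    hasGoodReductionAt_of_intModel q W' hI' hv hΔ', three_notMem_asIdeal_of_primesEquiv_eq q hq3 hv⟩
  exact not_isSquare_algebraMap_adicCompletion_of_sqFlagAt v hv hD
    ((neg_c₄_div_c₆_eq_intModel W hI).trans hγ) hw hw' hflag

/-! ### Kind (vi): good / multiplicative non-split, `3 ∉ v` -/

/-- **Kind (vi), decided** (`q ≠ 3`): `E` good at `v` (`q ∤ Δ(E₀)`), `E′` multiplicative (`q ∣ Δ(F₀)`,
`q ∤ c₄(F₀)`) and NOT split (`sqFlagAt q (N·D) w = false` for `γ(E′) = N/D`), `3 ∉ v`.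
[cite: SilvermanAEC2009, VII.5 Prop. 5.1] [cite: SilvermanATAEC1994, Ch. V Thm. 5.3] -/
theorem kind_vi_of_sqFlagAt (hq3 : q ≠ 3) (W W' : WeierstrassCurve ℚ) [W.IsElliptic] [W'.IsElliptic]
    [W.IsGloballyMinimal] [W'.IsGloballyMinimal] {E₀ F₀ : WeierstrassCurve ℤ}
    (hI : W.integralModelInt = E₀) (hI' : W'.integralModelInt = F₀)
    {v : HeightOneSpectrum (𝓞 ℚ)} (hv : (primesEquiv v : ℕ) = q) (hΔ : ¬ (q : ℤ) ∣ E₀.Δ)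
    (hΔ' : (q : ℤ) ∣ F₀.Δ) (hc₄' : ¬ (q : ℤ) ∣ F₀.c₄) {N D : ℤ} (hD : D ≠ 0)
    (hγ' : -((F₀.c₄ : ℚ) / (F₀.c₆ : ℚ)) = (N : ℚ) / (D : ℚ))
    {w : ℕ} (hw : (q : ℤ) ^ w ∣ N * D) (hw' : ¬ (q : ℤ) ^ (w + 1) ∣ N * D)
    (hflag : sqFlagAt q (N * D) w = false) :
    W.HasGoodReductionAt v ∧ W'.HasMultiplicativeReductionAt v ∧
      ¬ IsSquare (algebraMap ℚ (v.adicCompletion ℚ) (-(W'.c₄ / W'.c₆))) ∧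
      ((3 : ℕ) : 𝓞 ℚ) ∉ v.asIdeal := by
  refine ⟨hasGoodReductionAt_of_intModel q W hI hv hΔ, hasMultiplicativeReductionAt_of_intModel q W' hI' hv hΔ' hc₄',
    ?_, three_notMem_asIdeal_of_primesEquiv_eq q hq3 hv⟩
  exact not_isSquare_algebraMap_adicCompletion_of_sqFlagAt v hv hD
    ((neg_c₄_div_c₆_eq_intModel W' hI').trans hγ') hw hw' hflag

/-! ### Kind (iii′): `|j|_v > 1` on both sides, same twist class, `μ₃(ℚ_v) = 1` -/

/-- **Kind (iii′), decided** (this lineage's Tate road, ROUTE-1 §42; the one kind usable AT `3`):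
`1 < v(j(E))` and `1 < v(j(E′))` from `ord_q j < 0` read off the integer models (`q^{a+1} ∤ c₄`,
`q^{3a+1} ∣ Δ` on `E₀`; `q^{a′+1} ∤ c₄`, `q^{3a′+1} ∣ Δ` on `F₀`), same twist class by
`sqFlagAt q (N·D) w = true` (`γ(E)/γ(E′) = N/D`), `μ₃(ℚ_v) = 1` by `sqFlagAt q (−3) w₃ = false`.
[cite: SilvermanATAEC1994, Ch. V Lemma 5.2 (c), Thm. 5.3, Cor. 5.4] [cite: Serre1973, Ch. II §3.3] -/
theorem kind_iii'_of_sqFlagAt (W W' : WeierstrassCurve ℚ) [W.IsElliptic] [W'.IsElliptic]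
    [W.IsGloballyMinimal] [W'.IsGloballyMinimal] {E₀ F₀ : WeierstrassCurve ℤ}
    (hI : W.integralModelInt = E₀) (hI' : W'.integralModelInt = F₀)
    {v : HeightOneSpectrum (𝓞 ℚ)} (hv : (primesEquiv v : ℕ) = q)
    (a : ℕ) (hca : ¬ (q : ℤ) ^ (a + 1) ∣ E₀.c₄) (hΔa : (q : ℤ) ^ (3 * a + 1) ∣ E₀.Δ)
    (a' : ℕ) (hca' : ¬ (q : ℤ) ^ (a' + 1) ∣ F₀.c₄) (hΔa' : (q : ℤ) ^ (3 * a' + 1) ∣ F₀.Δ)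
    (hc₆' : F₀.c₆ ≠ 0) {N D : ℤ} (hD : D ≠ 0)
    (hAB : (-((E₀.c₄ : ℚ) / (E₀.c₆ : ℚ))) / (-((F₀.c₄ : ℚ) / (F₀.c₆ : ℚ))) = (N : ℚ) / (D : ℚ))
    {w : ℕ} (hw : (q : ℤ) ^ w ∣ N * D) (hw' : ¬ (q : ℤ) ^ (w + 1) ∣ N * D)
    (hflag : sqFlagAt q (N * D) w = true)
    {w₃ : ℕ} (hw₃ : (q : ℤ) ^ w₃ ∣ (-3 : ℤ)) (hw₃' : ¬ (q : ℤ) ^ (w₃ + 1) ∣ (-3 : ℤ))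
    (hflag₃ : sqFlagAt q (-3) w₃ = false) :
    1 < v.valuation ℚ W.j ∧ 1 < v.valuation ℚ W'.j ∧
      (∃ r : v.adicCompletion ℚ, algebraMap ℚ (v.adicCompletion ℚ) (-(W.c₄ / W.c₆)) =
        r ^ 2 * algebraMap ℚ (v.adicCompletion ℚ) (-(W'.c₄ / W'.c₆))) ∧
      (∀ ζ : v.adicCompletion ℚ, ζ ^ 3 = 1 → ζ = 1) := by
  have hj : padicValRat q W.j < 0 := padicValRat_j_neg_of_intModel hI (p := q) a hca hΔa
  have hj' : padicValRat q W'.j < 0 := padicValRat_j_neg_of_intModel hI' (p := q) a' hca' hΔa'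
  have hjE0 : W.j ≠ 0 := fun h ↦ by rw [h, padicValRat.zero] at hj; exact lt_irrefl _ hj
  have hjF0 : W'.j ≠ 0 := fun h ↦ by rw [h, padicValRat.zero] at hj'; exact lt_irrefl _ hj'
  have hc₄F : F₀.c₄ ≠ 0 := fun h0 ↦ hca' (h0 ▸ dvd_zero _)
  have hB : -(W'.c₄ / W'.c₆) ≠ 0 := by
    rw [neg_c₄_div_c₆_eq_intModel W' hI', neg_ne_zero, div_ne_zero_iff]
    exact ⟨by exact_mod_cast hc₄F, by exact_mod_cast hc₆'⟩
  have hAB' : (-(W.c₄ / W.c₆)) / (-(W'.c₄ / W'.c₆)) = (N : ℚ) / (D : ℚ) := by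
    rw [neg_c₄_div_c₆_eq_intModel W hI, neg_c₄_div_c₆_eq_intModel W' hI']; exact hAB
  exact ⟨(TwistedKummer.one_lt_valuation_iff_padicValRat_neg v hv hjE0).mpr hj,
    (TwistedKummer.one_lt_valuation_iff_padicValRat_neg v hv hjF0).mpr hj',
    exists_eq_sq_mul_of_sqFlagAt v hv hB hD hAB' hw hw' hflag,
    forall_pow_three_eq_one_adicCompletion_of_sqFlagAt v hv hw₃ hw₃' hflag₃⟩

/-! ### Kind (vii): additive / additive, `3 ∉ v`, `#E′(ℚ_v)[3] = 3` (ROUTE-1 §44 L44 (b)) -/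

/-- **Kind (vii), decided** (`q ≠ 3`; route planner 1's tame two-line dichotomy L44 (b), the free-NEW
add/add places of the D44 family): both curves ADDITIVE at `v` (`q ∣ Δ`, `q ∣ c₄` on `E₀` and on the
partner's model `⟨a₁, …, a₆⟩`), `3 ∉ v`, and `#ker([3] : E′(ℚ_v)) = 3` from
`threeTorsionCheckAt q a₁ … a₆ k cert = some 1`. [cite: SilvermanAEC2009, VII.5 Prop. 5.1 (c)]
[cite: SilvermanAEC2009, VII.3.1 and Ex. 3.7] -/
theorem kind_vii_of_checkAt (hq3 : q ≠ 3) (W W' : WeierstrassCurve ℚ) [W.IsElliptic] [W'.IsElliptic]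
    [W.IsGloballyMinimal] [W'.IsGloballyMinimal] {E₀ : WeierstrassCurve ℤ} {a₁ a₂ a₃ a₄ a₆ : ℤ}
    (hI : W.integralModelInt = E₀) (hI' : W'.integralModelInt = ⟨a₁, a₂, a₃, a₄, a₆⟩)
    {v : HeightOneSpectrum (𝓞 ℚ)} (hv : (primesEquiv v : ℕ) = q)
    (hΔ : (q : ℤ) ∣ E₀.Δ) (hc₄ : (q : ℤ) ∣ E₀.c₄)
    (hΔ' : (q : ℤ) ∣ (⟨a₁, a₂, a₃, a₄, a₆⟩ : WeierstrassCurve ℤ).Δ)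
    (hc₄' : (q : ℤ) ∣ (⟨a₁, a₂, a₃, a₄, a₆⟩ : WeierstrassCurve ℤ).c₄)
    {k : ℕ} {cert : List (ℤ × ℕ × ℕ × ℕ)} (h : threeTorsionCheckAt q a₁ a₂ a₃ a₄ a₆ k cert = some 1) :
    W.HasAdditiveReductionAt v ∧ W'.HasAdditiveReductionAt v ∧ ((3 : ℕ) : 𝓞 ℚ) ∉ v.asIdeal ∧
      Nat.card (nsmulAddMonoidHom 3 : (W'.baseChange (v.adicCompletion ℚ)).toAffine.Point →+
        (W'.baseChange (v.adicCompletion ℚ)).toAffine.Point).ker = 3 := by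
  refine ⟨hasAdditiveReductionAt_of_intModel q W hI hv hΔ hc₄,
    hasAdditiveReductionAt_of_intModel q W' hI' hv hΔ' hc₄', three_notMem_asIdeal_of_primesEquiv_eq q hq3 hv, ?_⟩
  rw [natCard_ker_nsmul_three_adicCompletion_eq_of_intModel_of_checkAt q a₁ a₂ a₃ a₄ a₆ hq3 W' hI' h hv]

end Summit.BirchSwinnertonDyer.Rank1Residual.Additive.PlacesSeven

end
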